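import Literature.MathematicalPhysics.QuantumFieldTheory.Balaban1983to89.B5Hk165PolarZd
import Literature.MathematicalPhysics.QuantumFieldTheory.Balaban1983to89.B6QGQFourier275Zd
import Summits.QuantumFields.BalabanUV.Beta.FP.ConstrainedGhost

/-!
# Road FP (binder row D1), leaf H′2-IR ∕ IR-4b, STEPS (1)–(3) (helper of `FP/CoarseInverseScalar`): the blocked massless covariance
# `M(y,y′) = Σ_{p∈B(y)}Σ_{q∈B(y′)} G₀(p−q)` through pv23's penalised column — `(n+1)⁻²·M(y,y′) = (n+1)^d·(Q′G′Q′*)(y,y′) + (n+1)⁻²·Σ′_u (Q′G′Q′*)(y,u)·M(u,y′)`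

HONEST DEPENDENCY (page 1, mandatory): continuum YM on T⁴ ⇐ BetaPertH ∧ nine spine estimates (0/9 proved); BetaPertH ⇐ (D1) ∧ (D4) ∧
CAP+tail; G-an2-4 gates asym, D1 and NE2/3/4.  HONEST FRAMING (cell contract, verbatim): «discharging `BetaPertH` makes Bałaban's UV
stability UNCONDITIONAL — a real constructive-QFT result; it is NOT the continuum limit and NOT the Clay problem.»  THIS MODULE is [folklore]
resolvent bookkeeping over pv23's WHOLE-LATTICE SCALAR COLUMN BY NAME (`B6QGQLower276`: blocks `B n y`, `chart`, the site matrix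
`AX n a = (n+1)²(−Δ) + a(n+1)^{−d}1[same block]`, `kerQGQ`; `B6QGQDecay237`: `cU`∕`deltaU`∕`cInv`∕`deltaInv`, `abs_kerQGQ_le_unif`;
`B5Hk103ScalarZd`: `Gk = G′`, `Kinv = (Q′G′Q′*)⁻¹`, `abs_Gk_le`, `abs_Kinv_le`, `tsum_Kinv_mul_kerQGQ`, `tsum_mul_tsum_comm`, `tsum_blocks`,
`summable_expX`; `B6QGQFourier275Zd`: `rowAX_eq`, `eq_tsum_Gk_mul_rowAX` (bounded solutions are represented by `G′`), `sum_B_eq`;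
`B5Hk165ActionZd`: `actionKer = Kinv − aδ`; `B5Hk165PolarZd`: `actionKer_symm`) and lit1's free Green function
(`neg_latticeLaplacianZd_half_latticeGreen_sub`, `latticeGreen_le_latticeGreen_zero`, `latticeGreen_nonneg`, `latticeGreen_neg`); no `def`,
no `def … : Prop`, nothing cited, 0 sorry.  ROUTE OF RECORD per the owner's R-FP-21 (A3) (journal l.21280): NO new analysis — the decay
is pv23's mesh-free Combes–Thomas (`qGqInv_decay_unif`), the identity is the resolvent identity below.  It DISCHARGES the displayed hypothesis
(H-CINV) of leaf-05-g9's IR-4a (`hC`, `hCM`) and hence, with IR-4-IF ∕ IR-4a, the letters (T0)–(T2) of the ghost remainder; it does NOT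
touch `hasym` ∕ D1.  0∕4 binders of row D1; NOT D1, NOT BetaPertH, NOT continuum, NOT Clay.

ABSOLUTE RULE (cell charter, verbatim): «No internally-minted statement may enter as a cited fact. Every hypothesis is either kernel-proved
in this package or a verbatim quotation of a PUBLISHED theorem with page reference. The manuscript(s) under audit are NOT citable for their
own disputed steps — they are the thing under adjudication; programme-internal (2001/route/tribunal) claims are never citable.»

THE IDENTITY (block side `N = n+1`, `G₀ = latticeGreen∕2`, `−ΔG₀ = δ`, `d ≥ 3`; `G′ := Gk n 1 = ((n+1)²(−Δ) + (n+1)^{−d}Q′ᵀQ′)⁻¹`,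
`K := kerQGQ n 1 = (n+1)^{−d}·[block sums of G′]`, `Kinv := K⁻¹`, `M(y,y′) := Σ_{p∈B(y)}Σ_{q∈B(y′)} G₀(p−q)`).
(1) `φ_q := (n+1)⁻²G₀(·−q)` is BOUNDED and `AX·φ_q = δ_q + (n+1)^{−(d+2)}·S(blk ·, q)`, `S(u,q) := Σ_{r∈B(u)} G₀(r−q)` (`rowAX_eq` + `−ΔG₀ = δ`);
(2) `eq_tsum_Gk_mul_rowAX`: `(n+1)⁻²G₀(p−q) = G′(p,q) + (n+1)^{−(d+2)}·Σ′_z G′(p,z)·S(blk z, q)`;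
(3) block-summing over `p ∈ B(y)`, `q ∈ B(y′)` and regrouping `z` by blocks (`tsum_blocks`):
    `(n+1)⁻²·M(y,y′) = (n+1)^d·K(y,y′) + (n+1)⁻²·Σ′_u K(y,u)·M(u,y′)`;
(4) left-multiplying by `Kinv` (`tsum_Kinv_mul_kerQGQ`, Fubini `tsum_mul_tsum_comm` under the exp × exp × bounded majorant):
    `Σ′_y Kinv(x,y)·M(y,y′) = (n+1)^{d+2}·[x = y′] + M(x,y′)`, i.e. **`Σ′_y actionKer n 1 x y · M(y,y′) = (n+1)^{d+2}·[x = y′]`**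
    (`actionKer = Kinv − 1·δ` — «(Q′G₀Q′ᵀ)⁻¹ = (Q′G(a)Q′ᵀ)⁻¹ − a» with the zero mode already handled by pv23);
(5) mirror by the symmetry of `M` (`G₀` even) and of `actionKer`; (6) the an2-currency bracket of `ConstrainedGhost.coarse_woodbury`
    (`Σ_{b∈box} blockSum N (G₀(N•v + b − ·)) w`) IS `M(v,w)` (`sum_B_eq_blockSum`).
CONTENT (this file = steps (1)–(3); the headline file `FP/CoarseInverseScalar` = step (4), (C1)–(C3) and leaf-05-g9's spelling; split only for the
400-line rule). §1 the free leg and `M`; §2 an2 ↔ pv23 blocks (`sum_B_eq_blockSum`, `bracket_eq_M`); §3 steps (1)–(2) (`rowAX_freeCol`, `freeCol_eq`);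
§4 step (3) (`M_div_eq`).
Unit `b2b-balaban-beta-d1-formalise-leaf-06` (gen 7), 2026-08-20; `LEAVES-FP.md` row IR-4b (owner R-FP-21 (A3) l.21280, INTENT l.≈21536).
-/

namespace Summit.QuantumFields.BalabanUV.Beta.FP.CoarseInverseScalarSteps

open Finset
open scoped BigOperators
open Literature.Probability.LatticeModels (latticeGreen latticeLaplacianZd neg_latticeLaplacianZd_half_latticeGreen_sub
  latticeGreen_le_latticeGreen_zero latticeGreen_nonneg latticeGreen_neg)
open Literature.MathematicalPhysics.QuantumFieldTheory.Balaban1983to89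
open B6QGQLower276 (X e B blk chart side AX kerQGQ mem_B chart_mem_B sum_B_const)
open B6QGQDecay237 (cU deltaU cInv deltaInv cU_pos deltaU_pos cInv_pos deltaInv_pos abs_kerQGQ_le_unif)
open B5Hk103ScalarZd (Gk Kinv abs_Gk_le abs_Kinv_le tsum_Kinv_mul_kerQGQ tsum_mul_tsum_comm tsum_blocks summable_expX)
open B6QGQFourier275Zd (rowAX rowAX_eq eq_tsum_Gk_mul_rowAX sum_B_eq)
open B5Hk165ActionZd (actionKer)
open B5Hk165PolarZd (actionKer_symm)
open Literature.MathematicalPhysics.QuantumFieldTheory.Balaban1983to89.Beta.AffineAveraging (blockSum toSite)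

noncomputable section

variable {d : ℕ}

/-! ## §1 The free leg `G₀ = latticeGreen∕2` and the blocked covariance `M` -/

/-- [folklore] `|G₀ z| ≤ G₀ 0` (`d ≥ 3`). -/
theorem abs_G0_le (hd : 3 ≤ d) (z : X d) : |latticeGreen z / 2| ≤ latticeGreen (0 : X d) / 2 := by
  rw [abs_of_nonneg (by have := latticeGreen_nonneg d hd z; positivity)]
  exact div_le_div_of_nonneg_right (latticeGreen_le_latticeGreen_zero hd z) (by norm_num)

/-- [folklore] The block column `S(u,q) := Σ_{r ∈ B(u)} G₀(r − q)` is bounded by `(n+1)^d·G₀(0)`. -/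
theorem abs_blockCol_le (hd : 3 ≤ d) (n : ℕ) (u q : X d) :
    |∑ r ∈ B n u, latticeGreen (r - q) / 2| ≤ ((n : ℝ) + 1) ^ d * (latticeGreen (0 : X d) / 2) := by
  calc |∑ r ∈ B n u, latticeGreen (r - q) / 2| ≤ ∑ r ∈ B n u, |latticeGreen (r - q) / 2| := abs_sum_le_sum_abs _ _
    _ ≤ ∑ _r ∈ B n u, latticeGreen (0 : X d) / 2 := sum_le_sum fun r _ => abs_G0_le hd _
    _ = ((n : ℝ) + 1) ^ d * (latticeGreen (0 : X d) / 2) := sum_B_const u _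

/-- [folklore] `M(y,y′) := Σ_{p∈B(y)} Σ_{q∈B(y′)} G₀(p−q)` is bounded by `(n+1)^{2d}·G₀(0)`. -/
theorem abs_M_le (hd : 3 ≤ d) (n : ℕ) (y y' : X d) :
    |∑ p ∈ B n y, ∑ q ∈ B n y', latticeGreen (p - q) / 2| ≤ ((n : ℝ) + 1) ^ d * (((n : ℝ) + 1) ^ d * (latticeGreen (0 : X d) / 2)) := by
  calc |∑ p ∈ B n y, ∑ q ∈ B n y', latticeGreen (p - q) / 2| ≤ ∑ p ∈ B n y, |∑ q ∈ B n y', latticeGreen (p - q) / 2| :=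
        abs_sum_le_sum_abs _ _
    _ ≤ ∑ p ∈ B n y, ((n : ℝ) + 1) ^ d * (latticeGreen (0 : X d) / 2) := by
        refine sum_le_sum fun p _ => ?_
        calc |∑ q ∈ B n y', latticeGreen (p - q) / 2| ≤ ∑ q ∈ B n y', |latticeGreen (p - q) / 2| := abs_sum_le_sum_abs _ _
          _ ≤ ∑ _q ∈ B n y', latticeGreen (0 : X d) / 2 := sum_le_sum fun q _ => abs_G0_le hd _
          _ = ((n : ℝ) + 1) ^ d * (latticeGreen (0 : X d) / 2) := sum_B_const y' _
    _ = ((n : ℝ) + 1) ^ d * (((n : ℝ) + 1) ^ d * (latticeGreen (0 : X d) / 2)) := sum_B_const y _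

/-- [folklore] `M` is symmetric (`G₀` is even). -/
theorem M_symm (n : ℕ) (y y' : X d) :
    ∑ p ∈ B n y, ∑ q ∈ B n y', latticeGreen (p - q) / 2 = ∑ q ∈ B n y', ∑ p ∈ B n y, latticeGreen (q - p) / 2 := by
  rw [Finset.sum_comm]
  refine sum_congr rfl fun q _ => sum_congr rfl fun p _ => ?_
  rw [← latticeGreen_neg, neg_sub]

/-! ## §2 an2's blocks are pv23's blocks: `blockSum (n+1) f y = Σ_{p ∈ B n y} f p` -/

/-- [folklore] an2's offset box `AffineAveraging.box d (n+1)` is the image of `Fin d → Fin (n+1)` under `z ↦ (z ·)`. -/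
theorem box_eq_image (d n : ℕ) :
    Literature.MathematicalPhysics.QuantumFieldTheory.Balaban1983to89.Beta.AffineAveraging.box d (n + 1)
      = (Finset.univ : Finset (Fin d → Fin (n + 1))).image (fun z i => (z i : ℕ)) := by
  ext b
  simp only [Literature.MathematicalPhysics.QuantumFieldTheory.Balaban1983to89.Beta.AffineAveraging.box, Fintype.mem_piFinset,
    Finset.mem_range, Finset.mem_image, Finset.mem_univ, true_and]
  constructor
  · intro h
    exact ⟨fun i => ⟨b i, h i⟩, funext fun i => rfl⟩
  · rintro ⟨z, rfl⟩ i
    exact (z i).isLt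

/-- [folklore] **THE BLOCK DICTIONARY**: `Σ_{p ∈ B n y} f p = blockSum (n+1) f y` (pv23's `chart n y z` = an2's `(n+1)•y + toSite (z ·)`). -/
theorem sum_B_eq_blockSum (n : ℕ) (f : X d → ℝ) (y : X d) :
    ∑ p ∈ B n y, f p = blockSum (n + 1) f y := by
  classical
  simp only [Literature.MathematicalPhysics.QuantumFieldTheory.Balaban1983to89.Beta.AffineAveraging.blockSum]
  rw [sum_B_eq, box_eq_image,
    Finset.sum_image (fun z _ z' _ h => by
      funext i; apply Fin.ext; exact congrFun h i)]
  refine Finset.sum_congr rfl fun z _ => ?_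
  congr 1

/-- [folklore] The bracket of `ConstrainedGhost.coarse_woodbury` IS `M`:
`Σ_{b ∈ box} blockSum (n+1) (G₀((n+1)•v + toSite b − ·)) w = Σ_{p∈B(v)} Σ_{q∈B(w)} G₀(p − q)`. -/
theorem bracket_eq_M (n : ℕ) (v w : X d) :
    ∑ b ∈ Literature.MathematicalPhysics.QuantumFieldTheory.Balaban1983to89.Beta.AffineAveraging.box d (n + 1),
        blockSum (n + 1) (fun z => latticeGreen ((((n + 1 : ℕ) : ℤ)) • v + toSite b - z) / 2) w
      = ∑ p ∈ B n v, ∑ q ∈ B n w, latticeGreen (p - q) / 2 := by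
  rw [sum_B_eq_blockSum n (fun p => ∑ q ∈ B n w, latticeGreen (p - q) / 2) v]
  simp only [Literature.MathematicalPhysics.QuantumFieldTheory.Balaban1983to89.Beta.AffineAveraging.blockSum]
  refine Finset.sum_congr rfl fun b _ => ?_
  have h := sum_B_eq_blockSum n (fun q => latticeGreen ((((n + 1 : ℕ) : ℤ)) • v + toSite b - q) / 2) w
  simp only [Literature.MathematicalPhysics.QuantumFieldTheory.Balaban1983to89.Beta.AffineAveraging.blockSum] at h
  exact h.symm

/-! ## §3 Steps (1)–(2): the free column through pv23's `G′` -/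

/-- [folklore] STEP (1): the row action of `AX n 1` on `φ_q = (n+1)⁻²G₀(·−q)` is `δ_q + (n+1)^{−(d+2)}·S(blk ·, q)`. -/
theorem rowAX_freeCol (hd : 3 ≤ d) (n : ℕ) (q z : X d) :
    rowAX n 1 (fun p => latticeGreen (p - q) / 2 / ((n : ℝ) + 1) ^ 2) z
      = (if z = q then 1 else 0) + (((n : ℝ) + 1) ^ (d + 2))⁻¹ * ∑ r ∈ B n (blk n z), latticeGreen (r - q) / 2 := by
  have hN : (0 : ℝ) < (n : ℝ) + 1 := by positivity
  rw [rowAX_eq]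
  have hlap : ((n : ℝ) + 1) ^ 2 * ∑ μ, (2 * (latticeGreen (z - q) / 2 / ((n : ℝ) + 1) ^ 2)
      - latticeGreen (z + e μ - q) / 2 / ((n : ℝ) + 1) ^ 2 - latticeGreen (z - e μ - q) / 2 / ((n : ℝ) + 1) ^ 2)
      = -latticeLaplacianZd (fun w => latticeGreen (w - q) / 2) z := by
    have hN2 : ((n : ℝ) + 1) ^ 2 ≠ 0 := by positivity
    have hterm : ∀ μ : Fin d, ((n : ℝ) + 1) ^ 2 * (2 * (latticeGreen (z - q) / 2 / ((n : ℝ) + 1) ^ 2)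
        - latticeGreen (z + e μ - q) / 2 / ((n : ℝ) + 1) ^ 2 - latticeGreen (z - e μ - q) / 2 / ((n : ℝ) + 1) ^ 2)
        = 2 * (latticeGreen (z - q) / 2) - (latticeGreen (z + Pi.single μ 1 - q) / 2 + latticeGreen (z - Pi.single μ 1 - q) / 2) := by
      intro μ
      simp only [e]
      field_simp
      ring
    rw [Finset.mul_sum]
    simp_rw [hterm]
    simp only [latticeLaplacianZd, Finset.sum_sub_distrib, Finset.sum_const, Finset.card_univ, Fintype.card_fin, nsmul_eq_mul]
    ring
  rw [hlap, neg_latticeLaplacianZd_half_latticeGreen_sub d hd q z]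
  congr 1
  rw [Finset.mul_sum, Finset.mul_sum]
  refine Finset.sum_congr rfl fun r _ => ?_
  rw [pow_add]
  field_simp

/-- [folklore] summability of `z ↦ G′(p,z)·f z` for bounded `f`. -/
theorem summable_Gk_mul_bdd (n : ℕ) (p : X d) {f : X d → ℝ} {C : ℝ} (hf : ∀ z, |f z| ≤ C) :
    Summable fun z => Gk n 1 p z * f z := by
  have hα : 0 < deltaU d 1 / ((n : ℝ) + 1) := div_pos (deltaU_pos d one_pos) (by positivity)
  refine Summable.of_norm_bounded ((summable_expX hα p).mul_left (2 / min 2 1 * C)) fun z => ?_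
  rw [Real.norm_eq_abs, abs_mul]
  have h1 := abs_Gk_le n one_pos p z
  have hC : 0 ≤ C := (abs_nonneg _).trans (hf z)
  have e1 : Real.exp (-(deltaU d 1 * (dist p z / ((n : ℝ) + 1)))) = Real.exp (-(deltaU d 1 / ((n : ℝ) + 1) * dist p z)) := by
    congr 1; ring
  rw [e1] at h1
  calc |Gk n 1 p z| * |f z| ≤ (2 / min 2 1 * Real.exp (-(deltaU d 1 / ((n : ℝ) + 1) * dist p z))) * C :=
        mul_le_mul h1 (hf z) (abs_nonneg _) (by positivity)
    _ = 2 / min 2 1 * C * Real.exp (-(deltaU d 1 / ((n : ℝ) + 1) * dist p z)) := by ring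

/-- [folklore] STEP (2): **`(n+1)⁻²G₀(p−q) = G′(p,q) + (n+1)^{−(d+2)}·Σ′_z G′(p,z)·S(blk z, q)`** (bounded solutions are represented by `G′`). -/
theorem freeCol_eq (hd : 3 ≤ d) (n : ℕ) (p q : X d) :
    latticeGreen (p - q) / 2 / ((n : ℝ) + 1) ^ 2
      = Gk n 1 p q + (((n : ℝ) + 1) ^ (d + 2))⁻¹ * ∑' z, Gk n 1 p z * ∑ r ∈ B n (blk n z), latticeGreen (r - q) / 2 := by
  have hφ : ∀ r : X d, |latticeGreen (r - q) / 2 / ((n : ℝ) + 1) ^ 2| ≤ latticeGreen (0 : X d) / 2 / ((n : ℝ) + 1) ^ 2 := by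
    intro r
    rw [abs_div, abs_of_pos (by positivity : (0 : ℝ) < ((n : ℝ) + 1) ^ 2)]
    exact div_le_div_of_nonneg_right (abs_G0_le hd _) (by positivity)
  have h := eq_tsum_Gk_mul_rowAX n one_pos hφ p
  rw [h]
  simp_rw [rowAX_freeCol hd n q, mul_add]
  have hs1 : Summable fun z : X d => Gk n 1 p z * (if z = q then (1 : ℝ) else 0) :=
    summable_of_ne_finset_zero (s := {q}) (fun z hz => by rw [Finset.mem_singleton] at hz; simp [hz])
  have hs2 : Summable fun z : X d => Gk n 1 p z * ((((n : ℝ) + 1) ^ (d + 2))⁻¹ * ∑ r ∈ B n (blk n z), latticeGreen (r - q) / 2) := by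
    have := (summable_Gk_mul_bdd n p (fun z => abs_blockCol_le hd n (blk n z) q)).mul_left ((((n : ℝ) + 1) ^ (d + 2))⁻¹)
    refine this.congr fun z => ?_
    ring
  rw [hs1.tsum_add hs2]
  congr 1
  · rw [tsum_eq_single q (fun z hz => by simp [hz])]
    simp
  · rw [← tsum_mul_left]
    exact tsum_congr fun z => by ring

/-! ## §4 Step (3): block sums — `(n+1)⁻²·M(y,y′) = (n+1)^d·K(y,y′) + (n+1)⁻²·Σ′_u K(y,u)·M(u,y′)` -/

/-- [folklore] `Σ_{p∈B(y)} Σ_{q∈B(y′)} G′(p,q) = (n+1)^d · (Q′G′Q′*)(y,y′)` (the definition of `kerQGQ`). -/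
theorem sum_sum_Gk_eq (n : ℕ) (y y' : X d) :
    ∑ p ∈ B n y, ∑ q ∈ B n y', Gk n 1 p q = ((n : ℝ) + 1) ^ d * kerQGQ n 1 y y' := by
  have hN : (0 : ℝ) < ((n : ℝ) + 1) ^ d := by positivity
  unfold kerQGQ
  rw [← mul_assoc, mul_inv_cancel₀ hN.ne', one_mul]
  rfl

/-- [folklore] STEP (3): **the blocked covariance through the penalised coarse operator** —
`M(y,y′)∕(n+1)² = (n+1)^d·K(y,y′) + (n+1)⁻²·Σ′_u K(y,u)·M(u,y′)`, `K = kerQGQ n 1`. -/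
theorem M_div_eq (hd : 3 ≤ d) (n : ℕ) (y y' : X d) :
    (∑ p ∈ B n y, ∑ q ∈ B n y', latticeGreen (p - q) / 2) / ((n : ℝ) + 1) ^ 2
      = ((n : ℝ) + 1) ^ d * kerQGQ n 1 y y'
        + (((n : ℝ) + 1) ^ 2)⁻¹ * ∑' u, kerQGQ n 1 y u * ∑ p ∈ B n u, ∑ q ∈ B n y', latticeGreen (p - q) / 2 := by
  have hN : (0 : ℝ) < (n : ℝ) + 1 := by positivity
  set c : ℝ := (((n : ℝ) + 1) ^ (d + 2))⁻¹ with hc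
  -- the summable family `z ↦ G′(p,z)·S(blk z, q)`
  have hsum : ∀ p q : X d, Summable fun z : X d => Gk n 1 p z * ∑ r ∈ B n (blk n z), latticeGreen (r - q) / 2 :=
    fun p q => summable_Gk_mul_bdd n p (fun z => abs_blockCol_le hd n (blk n z) q)
  -- LHS through `freeCol_eq`
  have h1 : (∑ p ∈ B n y, ∑ q ∈ B n y', latticeGreen (p - q) / 2) / ((n : ℝ) + 1) ^ 2
      = ∑ p ∈ B n y, ∑ q ∈ B n y', (Gk n 1 p q + c * ∑' z, Gk n 1 p z * ∑ r ∈ B n (blk n z), latticeGreen (r - q) / 2) := by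
    rw [Finset.sum_div]
    refine Finset.sum_congr rfl fun p _ => ?_
    rw [Finset.sum_div]
    refine Finset.sum_congr rfl fun q _ => ?_
    exact freeCol_eq hd n p q
  rw [h1]
  simp only [Finset.sum_add_distrib]
  rw [sum_sum_Gk_eq]
  congr 1
  -- the second term: pull the finite sums inside the series, regroup `z` by blocks
  have h2 : ∑ p ∈ B n y, ∑ q ∈ B n y', c * ∑' z, Gk n 1 p z * ∑ r ∈ B n (blk n z), latticeGreen (r - q) / 2
      = c * ∑' z, (∑ p ∈ B n y, Gk n 1 p z) * ∑ r ∈ B n (blk n z), ∑ q ∈ B n y', latticeGreen (r - q) / 2 := by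
    have e1 : ∀ p ∈ B n y, ∑ q ∈ B n y', c * ∑' z, Gk n 1 p z * ∑ r ∈ B n (blk n z), latticeGreen (r - q) / 2
        = c * ∑' z, Gk n 1 p z * ∑ q ∈ B n y', ∑ r ∈ B n (blk n z), latticeGreen (r - q) / 2 := by
      intro p _
      rw [← Finset.mul_sum, ← Summable.tsum_finsetSum (fun q _ => hsum p q)]
      congr 1
      refine tsum_congr fun z => ?_
      rw [Finset.mul_sum]
    rw [Finset.sum_congr rfl e1, ← Finset.mul_sum]
    congr 1
    have hsum' : ∀ p ∈ B n y, Summable fun z : X d => Gk n 1 p z * ∑ q ∈ B n y', ∑ r ∈ B n (blk n z), latticeGreen (r - q) / 2 := by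
      intro p _
      refine summable_Gk_mul_bdd n p (C := ((n : ℝ) + 1) ^ d * (((n : ℝ) + 1) ^ d * (latticeGreen (0 : X d) / 2))) fun z => ?_
      rw [Finset.sum_comm]
      exact abs_M_le hd n (blk n z) y'
    rw [← Summable.tsum_finsetSum hsum']
    refine tsum_congr fun z => ?_
    rw [Finset.sum_mul]
    refine Finset.sum_congr rfl fun p _ => ?_
    rw [Finset.sum_comm]
  rw [h2]
  -- regroup `z` by blocks: `Σ′_z F(z) = Σ′_u Σ_{z ∈ B u} F(z)` with `blk z = u` on `B u`
  have hF : Summable fun z : X d => (∑ p ∈ B n y, Gk n 1 p z) * ∑ r ∈ B n (blk n z), ∑ q ∈ B n y', latticeGreen (r - q) / 2 := by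
    have : Summable fun z : X d => ∑ p ∈ B n y, Gk n 1 p z * ∑ r ∈ B n (blk n z), ∑ q ∈ B n y', latticeGreen (r - q) / 2 := by
      refine summable_sum fun p _ => summable_Gk_mul_bdd n p
        (C := ((n : ℝ) + 1) ^ d * (((n : ℝ) + 1) ^ d * (latticeGreen (0 : X d) / 2))) fun z => ?_
      exact abs_M_le hd n (blk n z) y'
    refine this.congr fun z => ?_
    rw [Finset.sum_mul]
  rw [← tsum_blocks n hF]
  have h3 : ∀ u : X d, ∑ z ∈ B n u, (∑ p ∈ B n y, Gk n 1 p z) * ∑ r ∈ B n (blk n z), ∑ q ∈ B n y', latticeGreen (r - q) / 2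
      = ((n : ℝ) + 1) ^ d * kerQGQ n 1 y u * ∑ p ∈ B n u, ∑ q ∈ B n y', latticeGreen (p - q) / 2 := by
    intro u
    have e2 : ∀ z ∈ B n u, (∑ p ∈ B n y, Gk n 1 p z) * ∑ r ∈ B n (blk n z), ∑ q ∈ B n y', latticeGreen (r - q) / 2
        = (∑ p ∈ B n y, Gk n 1 p z) * ∑ r ∈ B n u, ∑ q ∈ B n y', latticeGreen (r - q) / 2 := by
      intro z hz
      rw [mem_B.1 hz]
    rw [Finset.sum_congr rfl e2, ← Finset.sum_mul, ← sum_sum_Gk_eq n y u, Finset.sum_comm]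
  simp_rw [h3]
  have e3 : ∑' u : X d, ((n : ℝ) + 1) ^ d * kerQGQ n 1 y u * ∑ p ∈ B n u, ∑ q ∈ B n y', latticeGreen (p - q) / 2
      = ((n : ℝ) + 1) ^ d * ∑' u : X d, kerQGQ n 1 y u * ∑ p ∈ B n u, ∑ q ∈ B n y', latticeGreen (p - q) / 2 := by
    rw [← tsum_mul_left]
    exact tsum_congr fun u => by ring
  rw [e3, ← mul_assoc]
  congr 1
  rw [hc, pow_add, mul_inv]
  field_simp


end

end Summit.QuantumFields.BalabanUV.Beta.FP.CoarseInverseScalarSteps
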